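import Mathlib
import Literature.AlgebraicGeometry.Resolution.AffineDomainDimension
import HarnessLib

/-!
# The Veronese subring `k[s², st, t²] ⊆ k[s, t]` is not a regular ring

Route `FrobeniusLadder`, crux `FRationalResolution` (stmt-ResolutionOfSingularities-15317), line
`Sketch`: the quadric cone `R = k[s², st, t²] ≅ k[x, y, z]/(xz - y²)`, a direct summand of the
regular ring `k[s, t]`, is NOT regular in the sense of Mathlib's `IsRegularRing` (Noetherian with all
localizations at primes regular local). Hence the class of rings satisfying the stalk clause of the
crux (which contains every direct summand of a regular domain) is strictly larger than the class of
regular rings.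

Proof (denominator clearing, no cotangent spaces). Every element of `R` has no monomials of total
degree `1` (`veronese_not_isRegularRing_coeff_eq_zero_of_mem_adjoin`). Let `𝔪 ⊆ R` be the vertex, the
kernel of evaluation at the origin; it is maximal. If `R` were regular, `A = R_𝔪` would be a regular
local ring of dimension `ht 𝔪 ≤ dim R = dim k[s, t] = 2` (`k[s, t]` is integral over `R`,
`Literature.AlgebraicGeometry.Resolution.ringKrullDim_eq_of_isIntegral`), so `𝔪 A` is generated by
`≤ 2` elements, which after clearing denominators are `a, b ∈ 𝔪`, and for each `g ∈ 𝔪` some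
`u ∉ 𝔪` has `u g ∈ (a, b) R` (`veronese_not_isRegularRing_exists_finset`). Taking degree-`2`
homogeneous components in `k[s, t]` — where the absence of degree-`1` monomials gives
`(r a)₂ = r(0) • a₂` for `a(0) = 0` (`veronese_not_isRegularRing_homogeneousComponent_two_mul`) —
shows that `s², st, t²` lie in the `k`-span of `a₂, b₂`, contradicting their linear independence.
[folklore; cf. BrunsHerzog1998, Ex. 2.2.24; Matsumura1987, §14]
-/

-- single-problem summit: the doubled namespace component is forced
set_option linter.dupNamespace false

noncomputable section

open MvPolynomial IsLocalRing

namespace Summit.ResolutionOfSingularities.ResolutionOfSingularities.Theorems.FRationalResolution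

/-- Polynomials without degree-`1` monomials are closed under multiplication:
`(x y)₁ = x₀ y₁ + x₁ y₀ = 0`. [folklore] -/
theorem veronese_not_isRegularRing_coeff_mul_of_degree_eq_one {k : Type*} [CommSemiring k]
    {σ : Type*} {x y : MvPolynomial σ k} (hx : ∀ d : σ →₀ ℕ, d.degree = 1 → coeff d x = 0)
    (hy : ∀ d : σ →₀ ℕ, d.degree = 1 → coeff d y = 0) {d : σ →₀ ℕ} (hd : d.degree = 1) :
    coeff d (x * y) = 0 := by
  classical
  rw [coeff_mul]
  refine Finset.sum_eq_zero fun e he => ?_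
  rw [Finset.HasAntidiagonal.mem_antidiagonal] at he
  have hdeg := congrArg Finsupp.degree he
  rw [map_add, hd] at hdeg
  rcases Nat.eq_zero_or_pos e.1.degree with h | h
  · rw [hy e.2 (by omega), mul_zero]
  · rw [hx e.1 (by omega), zero_mul]

/-- If `r` and `a` have no degree-`1` monomials and `a` has zero constant term, then the degree-`2`
coefficients of `r a` are `r(0)` times those of `a`. [folklore] -/
theorem veronese_not_isRegularRing_coeff_mul_of_degree_eq_two {k : Type*} [CommSemiring k]
    {σ : Type*} {r a : MvPolynomial σ k} (hr : ∀ d : σ →₀ ℕ, d.degree = 1 → coeff d r = 0)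
    (ha0 : constantCoeff a = 0) {d : σ →₀ ℕ} (hd : d.degree = 2) :
    coeff d (r * a) = constantCoeff r * coeff d a := by
  classical
  rw [coeff_mul, show constantCoeff r = coeff 0 r from rfl]
  refine Finset.sum_eq_single (0, d) ?_ ?_
  · rintro ⟨d1, d2⟩ hmem hne
    simp only [Finset.HasAntidiagonal.mem_antidiagonal] at hmem
    have hdeg := congrArg Finsupp.degree hmem
    rw [map_add, hd] at hdeg
    by_cases h1 : d1.degree = 1
    · rw [hr d1 h1, zero_mul]
    by_cases h0 : d1.degree = 0
    · rw [Finsupp.degree_eq_zero_iff] at h0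
      subst h0
      rw [zero_add] at hmem
      subst hmem
      exact absurd rfl hne
    · have h2 : d2.degree = 0 := by omega
      rw [Finsupp.degree_eq_zero_iff] at h2
      subst h2
      rw [show coeff (0 : σ →₀ ℕ) a = constantCoeff a from rfl, ha0, mul_zero]
  · intro h
    exact absurd (Finset.HasAntidiagonal.mem_antidiagonal.mpr (zero_add d)) h

/-- Degree-`2` homogeneous component of a product `r a` with `a(0) = 0` and no degree-`1` monomials
in `r`: `(r a)₂ = r(0) • a₂`. [folklore] -/
theorem veronese_not_isRegularRing_homogeneousComponent_two_mul {k : Type*} [CommSemiring k]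
    {σ : Type*} {r a : MvPolynomial σ k} (hr : ∀ d : σ →₀ ℕ, d.degree = 1 → coeff d r = 0)
    (ha0 : constantCoeff a = 0) :
    homogeneousComponent 2 (r * a) = constantCoeff r • homogeneousComponent 2 a := by
  ext d
  rw [coeff_homogeneousComponent, coeff_smul, coeff_homogeneousComponent, smul_eq_mul]
  split_ifs with hd
  · exact veronese_not_isRegularRing_coeff_mul_of_degree_eq_two hr ha0 hd
  · exact (mul_zero _).symm

/-- Elements of the Veronese subalgebra `k[s², st, t²]` have no monomials of total degree `1`.
[folklore] -/
theorem veronese_not_isRegularRing_coeff_eq_zero_of_mem_adjoin {k : Type*} [Field k]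
    {x : MvPolynomial (Fin 2) k}
    (hx : x ∈ Algebra.adjoin k
      ({X 0 ^ 2, X 0 * X 1, X 1 ^ 2} : Set (MvPolynomial (Fin 2) k))) :
    ∀ d : Fin 2 →₀ ℕ, d.degree = 1 → coeff d x = 0 := by
  induction hx using Algebra.adjoin_induction with
  | mem x hx =>
    intro d hd
    have h2 : x.IsHomogeneous 2 := by
      simp only [Set.mem_insert_iff, Set.mem_singleton_iff] at hx
      rcases hx with rfl | rfl | rfl
      · exact isHomogeneous_X_pow 0 2
      · exact (isHomogeneous_X k 0).mul (isHomogeneous_X k 1)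
      · exact isHomogeneous_X_pow 1 2
    exact h2.coeff_eq_zero (by omega)
  | algebraMap c =>
    intro d hd
    exact (isHomogeneous_C (Fin 2) c).coeff_eq_zero (by omega)
  | add x y _ _ hx hy =>
    intro d hd
    rw [coeff_add, hx d hd, hy d hd, add_zero]
  | mul x y _ _ hx hy =>
    intro d hd
    exact veronese_not_isRegularRing_coeff_mul_of_degree_eq_one hx hy hd

/-- **Clearing denominators.** If the maximal ideal of `A_𝔭` is generated by `≤ n` elements, then
there are `≤ n` elements of `𝔭` such that every `g ∈ 𝔭` is, up to a factor `u ∉ 𝔭`, an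
`A`-linear combination of them. [folklore] -/
theorem veronese_not_isRegularRing_exists_finset {A : Type*} [CommRing A] (p : Ideal A)
    [p.IsPrime] {n : ℕ} (hfg : (maximalIdeal (Localization.AtPrime p)).FG)
    (hn : (maximalIdeal (Localization.AtPrime p)).spanFinrank ≤ n) :
    ∃ s : Finset A, s.card ≤ n ∧ (∀ x ∈ s, x ∈ p) ∧
      ∀ g ∈ p, ∃ u ∉ p, u * g ∈ Ideal.span (s : Set A) := by
  classical
  obtain ⟨t, htcard, htspan⟩ := Submodule.FG.exists_span_finset_card_eq_spanFinrank hfg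
  choose f hf using IsLocalization.surj (M := p.primeCompl) (S := Localization.AtPrime p)
  refine ⟨t.image fun z => (f z).1, Finset.card_image_le.trans (htcard ▸ hn), ?_, ?_⟩
  · intro x hx
    obtain ⟨z, hz, rfl⟩ := Finset.mem_image.mp hx
    have hzm : z ∈ maximalIdeal (Localization.AtPrime p) := htspan ▸ Submodule.subset_span hz
    rw [← IsLocalization.AtPrime.to_map_mem_maximal_iff (Localization.AtPrime p) p, ← hf z]
    exact Ideal.mul_mem_right _ _ hzm
  · intro g hg
    have hle : maximalIdeal (Localization.AtPrime p) ≤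
        (Ideal.span (↑(t.image fun z => (f z).1) : Set A)).map
          (algebraMap A (Localization.AtPrime p)) := by
      rw [← htspan]
      refine Submodule.span_le.mpr fun z hz => ?_
      refine (Ideal.mul_unit_mem_iff_mem _ (IsLocalization.map_units _ (f z).2)).mp ?_
      rw [hf z]
      exact Ideal.mem_map_of_mem _
        (Ideal.subset_span (Finset.mem_coe.mpr (Finset.mem_image_of_mem _ hz)))
    have hgm : algebraMap A (Localization.AtPrime p) g ∈ maximalIdeal _ :=
      (IsLocalization.AtPrime.to_map_mem_maximal_iff _ p g).mpr hg
    obtain ⟨u, hu, hug⟩ := (IsLocalization.algebraMap_mem_map_algebraMap_iff p.primeCompl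
      (Localization.AtPrime p) _ g).mp (hle hgm)
    exact ⟨u, Ideal.mem_primeCompl_iff.mp hu, hug⟩

/-- Inside a subalgebra `R ⊆ k[σ]` without degree-`1` monomials: if `s ⊆ R` consists of elements with
zero constant term, then every `y ∈ (s) R` has zero constant term and its degree-`2` component lies
in the `k`-span of the degree-`2` components of `s`. [folklore] -/
theorem veronese_not_isRegularRing_mem_span {k : Type*} [Field k] {σ : Type*}
    (R : Subalgebra k (MvPolynomial σ k))
    (hR : ∀ r ∈ R, ∀ d : σ →₀ ℕ, d.degree = 1 → coeff d r = 0)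
    (s : Finset R) (hs : ∀ x ∈ s, constantCoeff (x : MvPolynomial σ k) = 0)
    {y : R} (hy : y ∈ Ideal.span (s : Set R)) :
    constantCoeff (y : MvPolynomial σ k) = 0 ∧ homogeneousComponent 2 (y : MvPolynomial σ k) ∈
      Submodule.span k
        ((fun x : R => homogeneousComponent 2 (x : MvPolynomial σ k)) '' (s : Set R)) := by
  refine Submodule.span_induction
    (p := fun (y : R) _ => constantCoeff (y : MvPolynomial σ k) = 0 ∧
      homogeneousComponent 2 (y : MvPolynomial σ k) ∈ Submodule.span k
        ((fun x : R => homogeneousComponent 2 (x : MvPolynomial σ k)) '' (s : Set R)))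
    ?_ ?_ ?_ ?_ hy
  · exact fun x hx => ⟨hs x hx, Submodule.subset_span ⟨x, hx, rfl⟩⟩
  · exact ⟨by simp, by simp⟩
  · rintro x y - - ⟨hx0, hx⟩ ⟨hy0, hy⟩
    refine ⟨by rw [Subalgebra.coe_add, map_add, hx0, hy0, add_zero], ?_⟩
    rw [Subalgebra.coe_add, map_add]
    exact add_mem hx hy
  · rintro a x - ⟨hx0, hx⟩
    refine ⟨by rw [smul_eq_mul, Subalgebra.coe_mul, map_mul, hx0, mul_zero], ?_⟩
    rw [smul_eq_mul, Subalgebra.coe_mul,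
      veronese_not_isRegularRing_homogeneousComponent_two_mul (hR _ a.2) hx0]
    exact Submodule.smul_mem _ _ hx

/-- The monomials `s², st, t²` are linearly independent over `k` in `k[s, t]` (evaluate a relation
at `(1,0)`, `(0,1)`, `(1,1)`). [folklore] -/
theorem veronese_not_isRegularRing_linearIndependent (k : Type*) [Field k] :
    LinearIndependent k ![(X 0 ^ 2 : MvPolynomial (Fin 2) k), X 0 * X 1, X 1 ^ 2] := by
  rw [Fintype.linearIndependent_iff]
  intro g hg
  rw [Fin.sum_univ_three] at hg
  simp only [Matrix.cons_val_zero, Matrix.cons_val_one, Matrix.cons_val_two, Matrix.head_cons,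
    Matrix.tail_cons] at hg
  have h0 : g 0 = 0 := by simpa [smul_eval] using congr_arg (eval ![(1 : k), 0]) hg
  have h2 : g 2 = 0 := by simpa [smul_eval] using congr_arg (eval ![(0 : k), 1]) hg
  have h1 : g 1 = 0 := by simpa [smul_eval, h0, h2] using congr_arg (eval ![(1 : k), 1]) hg
  intro i
  fin_cases i
  · exact h0
  · exact h1
  · exact h2

/-- A `k`-subalgebra of `k[s, t]` containing `s²` and `t²` has Krull dimension `≤ 2`: `k[s, t]` is
integral over it, and Krull dimension is invariant under injective integral extensions.
[cite: Matsumura1987, Thm. 9.4 and Thm. 5.6] -/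
theorem veronese_not_isRegularRing_ringKrullDim_le {k : Type*} [Field k]
    (R : Subalgebra k (MvPolynomial (Fin 2) k))
    (hsq : ∀ i : Fin 2, (X i ^ 2 : MvPolynomial (Fin 2) k) ∈ R) : ringKrullDim R ≤ 2 := by
  have hX : ∀ i : Fin 2, IsIntegral R (X i : MvPolynomial (Fin 2) k) := fun i =>
    IsIntegral.of_pow two_pos (isIntegral_algebraMap (x := (⟨X i ^ 2, hsq i⟩ : R)))
  haveI : Algebra.IsIntegral R (MvPolynomial (Fin 2) k) := ⟨fun p => by
    induction p using MvPolynomial.induction_on with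
    | C c => exact isIntegral_algebraMap (x := algebraMap k R c)
    | add p q hp hq => exact hp.add hq
    | mul_X p i hp => exact hp.mul (hX i)⟩
  have hinj : Function.Injective (algebraMap R (MvPolynomial (Fin 2) k)) := Subtype.val_injective
  rw [← Literature.AlgebraicGeometry.Resolution.ringKrullDim_eq_of_isIntegral hinj,
    MvPolynomial.ringKrullDim_of_isNoetherianRing, ringKrullDim_eq_zero_of_field,
    Nat.card_eq_fintype_card, Fintype.card_fin, zero_add]
  norm_num

/-- Main step: a `k`-subalgebra `R ⊆ k[s, t]` of Krull dimension `≤ 2` without degree-`1` monomials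
and containing `s², st, t²` is not a regular ring — at the vertex the maximal ideal needs three
generators. [folklore; cf. BrunsHerzog1998, Ex. 2.2.24] -/
theorem veronese_not_isRegularRing_of_subalgebra {k : Type*} [Field k]
    (R : Subalgebra k (MvPolynomial (Fin 2) k))
    (hR : ∀ r ∈ R, ∀ d : Fin 2 →₀ ℕ, d.degree = 1 → coeff d r = 0)
    (h20 : (X 0 ^ 2 : MvPolynomial (Fin 2) k) ∈ R) (h11 : (X 0 * X 1 : MvPolynomial (Fin 2) k) ∈ R)
    (h02 : (X 1 ^ 2 : MvPolynomial (Fin 2) k) ∈ R) (hdim : ringKrullDim R ≤ 2) :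
    ¬ IsRegularRing R := by
  classical
  intro hreg
  -- the vertex `𝔪 = {r ∈ R | r(0) = 0}`, the kernel of evaluation at the origin, is maximal
  obtain ⟨ψ, hψ⟩ : ∃ ψ : R →+* k, ∀ r : R, ψ r = constantCoeff (r : MvPolynomial (Fin 2) k) :=
    ⟨constantCoeff.comp R.val.toRingHom, fun r => rfl⟩
  have hψs : Function.Surjective ψ := fun c => ⟨algebraMap k R c, by rw [hψ]; simp⟩
  haveI hm : (RingHom.ker ψ).IsMaximal := RingHom.ker_isMaximal_of_surjective ψ hψs
  have hmem : ∀ r : R, r ∈ RingHom.ker ψ ↔ constantCoeff (r : MvPolynomial (Fin 2) k) = 0 :=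
    fun r => by rw [RingHom.mem_ker, hψ]
  -- `R_𝔪` is regular local of dimension `ht 𝔪 ≤ dim R ≤ 2`, so `𝔪 R_𝔪` has `≤ 2` generators
  have hA : IsRegularLocalRing (Localization.AtPrime (RingHom.ker ψ)) :=
    IsRegularRing.isRegularLocalRing_localization (RingHom.ker ψ)
  have hn : (maximalIdeal (Localization.AtPrime (RingHom.ker ψ))).spanFinrank ≤ 2 := by
    have h := hA.spanFinrank_maximalIdeal.trans_le
      ((IsLocalization.AtPrime.ringKrullDim_eq_height (RingHom.ker ψ)
        (Localization.AtPrime (RingHom.ker ψ))).trans_le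
        (Ideal.height_le_ringKrullDim_of_isPrime.trans hdim))
    exact_mod_cast h
  obtain ⟨s, hscard, hsm, hsgen⟩ := veronese_not_isRegularRing_exists_finset (RingHom.ker ψ)
    (IsNoetherian.noetherian _) hn
  -- the degree-2 components of these `≤ 2` numerators span a plane `V` ...
  set f : R → MvPolynomial (Fin 2) k := fun x => homogeneousComponent 2 (x : MvPolynomial (Fin 2) k)
    with hf
  have hV : ∀ g : R, constantCoeff (g : MvPolynomial (Fin 2) k) = 0 →
      homogeneousComponent 2 (g : MvPolynomial (Fin 2) k) ∈
        Submodule.span k (↑(s.image f) : Set (MvPolynomial (Fin 2) k)) := by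
    intro g hg0
    obtain ⟨u, hu, hug⟩ := hsgen g ((hmem g).mpr hg0)
    have hu0 : constantCoeff (u : MvPolynomial (Fin 2) k) ≠ 0 := fun h => hu ((hmem u).mpr h)
    have key := (veronese_not_isRegularRing_mem_span R hR s
      (fun x hx => (hmem x).mp (hsm x hx)) hug).2
    rw [Subalgebra.coe_mul,
      veronese_not_isRegularRing_homogeneousComponent_two_mul (hR _ u.2) hg0] at key
    rw [Finset.coe_image]
    exact (Submodule.smul_mem_iff _ hu0).mp key
  -- ... which contains the three linearly independent forms `s², st, t²`: contradiction
  have hin : ∀ q : MvPolynomial (Fin 2) k, q.IsHomogeneous 2 → q ∈ R →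
      q ∈ (Submodule.span k (↑(s.image f) : Set (MvPolynomial (Fin 2) k)) :
        Set (MvPolynomial (Fin 2) k)) := by
    intro q hq hqR
    have hq0 : constantCoeff q = 0 := hq.coeff_eq_zero (d := 0) (by simp)
    simpa [homogeneousComponent_eq_self hq] using hV ⟨q, hqR⟩ hq0
  have hrange : Set.range ![(X 0 ^ 2 : MvPolynomial (Fin 2) k), X 0 * X 1, X 1 ^ 2] ⊆
      (Submodule.span k (↑(s.image f) : Set (MvPolynomial (Fin 2) k)) :
        Set (MvPolynomial (Fin 2) k)) := by
    rintro _ ⟨i, rfl⟩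
    fin_cases i
    · simpa using hin _ (isHomogeneous_X_pow 0 2) h20
    · simpa using hin _ ((isHomogeneous_X k 0).mul (isHomogeneous_X k 1)) h11
    · simpa using hin _ (isHomogeneous_X_pow 1 2) h02
  have h3 : Cardinal.mk (Fin 3) ≤ (s.image f).card := by
    simpa only [Finset.coe_sort_coe, Fintype.card_coe] using
      linearIndependent_le_span' _ (veronese_not_isRegularRing_linearIndependent k) _ hrange
  have h3' : 3 ≤ (s.image f).card := by
    rw [Cardinal.mk_fintype, Fintype.card_fin] at h3
    exact_mod_cast h3
  have h2 : (s.image f).card ≤ 2 := Finset.card_image_le.trans hscard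
  omega

/-- **The quadric cone is singular.** The Veronese subring `k[s², st, t²] ⊆ k[s, t]` (the affine
cone `xz = y²`, a direct summand of the regular ring `k[s, t]`) is not a regular ring: at the vertex
the maximal ideal needs `3 > 2 = dim` generators. [folklore; cf. BrunsHerzog1998, Ex. 2.2.24] -/
theorem veronese_not_isRegularRing (k : Type) [Field k] : ¬ IsRegularRing (Algebra.adjoin k ({MvPolynomial.X 0 ^ 2, MvPolynomial.X 0 * MvPolynomial.X 1, MvPolynomial.X 1 ^ 2} : Set (MvPolynomial (Fin 2) k))) := by
  have h20 : (X 0 ^ 2 : MvPolynomial (Fin 2) k) ∈ Algebra.adjoin k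
      ({X 0 ^ 2, X 0 * X 1, X 1 ^ 2} : Set (MvPolynomial (Fin 2) k)) :=
    Algebra.subset_adjoin (Set.mem_insert _ _)
  have h11 : (X 0 * X 1 : MvPolynomial (Fin 2) k) ∈ Algebra.adjoin k
      ({X 0 ^ 2, X 0 * X 1, X 1 ^ 2} : Set (MvPolynomial (Fin 2) k)) :=
    Algebra.subset_adjoin (Set.mem_insert_of_mem _ (Set.mem_insert _ _))
  have h02 : (X 1 ^ 2 : MvPolynomial (Fin 2) k) ∈ Algebra.adjoin k
      ({X 0 ^ 2, X 0 * X 1, X 1 ^ 2} : Set (MvPolynomial (Fin 2) k)) :=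
    Algebra.subset_adjoin (Set.mem_insert_of_mem _ (Set.mem_insert_of_mem _ rfl))
  refine veronese_not_isRegularRing_of_subalgebra _
    (fun r hr => veronese_not_isRegularRing_coeff_eq_zero_of_mem_adjoin hr) h20 h11 h02
    (veronese_not_isRegularRing_ringKrullDim_le _ fun i => ?_)
  fin_cases i
  · exact h20
  · exact h02

end Summit.ResolutionOfSingularities.ResolutionOfSingularities.Theorems.FRationalResolution

end
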